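import Summits.QuantumFields.BalabanUV.T4Continuum.Spine.NE3.LandauCorrectionSupB8FlatH0
import Summits.QuantumFields.BalabanUV.T4Continuum.Spine.NE3.FlatBlockHarmonicInverse
import Mathlib.Algebra.Order.Chebyshev
import HarnessLib

/-!
# T⁴ programme, node NE3 — census R38 (file 2∕2): (HR) AT THE FLAT DATUM FOR EVERY `(L, N, j)` — the `ℓ^∞ → ℓ^∞` bound of B8's (1.38)-projection `R(1)`
# onto `Δ_1N(Q′(1))`, k-UNIFORM; hence THE END's SUP LETTER `hK` AT `W = 1` IS UNCONDITIONAL ON EVERY TORUS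

Cell `pub-balaban-gaps` (YM blitz, track G2, seat `ne3`, unit `pub-balaban-gaps-ne3-g8`; writer prover-pub-balaban-gaps-ne3-g8-0, 2026-08-24), census
`run/shared/lean/pub/pub-balaban-gaps/ne/NE3.md` §4 R38, §14.  WHY.  After R37 (`LandauCorrectionSupB8FlatH0`: (H0) at `U = 1` for every `(L, N, j)`), the flat-
datum `hK` of THE END (`PairLandauB8EndSupFacts`) on a torus of size `N ≥ 2` rested on ONE displayed fact, (HR): for skew `(N·M)`-periodic `F` with `‖F‖_∞ ≤ B`
and `μ ∈ N(Q′(1))` with `F + Δ_1μ ⊥ Δ_1N(Q′(1))`, `‖Δ_1μ‖_∞ ≤ c_R·B` ([Balaban1985BackgroundPropagators] (3.25)∕(3.49) for `P = I − R` at `U = 1`, TYPE).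
THIS FILE PROVES IT, for every `L ≥ 2`, `N ≥ 1`, `j`, `d`, with `c_R = 1 + card n + 64^{2d+1}·d⁴·(card n)²·N^{d+2}` — INDEPENDENT of `j` (k-uniform; the torus
size `N` is fixed on rung (B)+1).  MECHANISM (`g := F + Δ_1μ`, `M = L^{j+1}`; file 1∕2 `FlatBlockHarmonicInverse` gives `Δ_1g = a∘blk_M` block-constant and the
inverse inequality `‖a‖₂²·M^{d+4} ≤ 16d²(card n)²64^{4d}‖g‖₂²`):
* §3 **`covLapSite_sup_le_flatCfg`** — (HR): `‖g‖₂ ≤ ‖F‖₂ ≤ (NM)^{d∕2}B` (orthogonality against `ν = μ`), `‖mean g‖ ≤ √(card n)·B`, and the lattice maximum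
  principle of R37 (`NE3DiscreteGradientEstimate.supRegularity_of_blockMeanZero` with ONE block = the whole torus) gives `‖g − mean g‖_∞ ≤ 16d³(NM)²·‖a‖_∞`
  with `‖a‖_∞² ≤ card n·‖a‖₂² ≲ M^{−d−4}(NM)^dB²`: every power of `M` cancels and `‖Δ_1μ‖_∞ = ‖g − F‖_∞ ≤ c_R·B`.
* §4 **`landauCorrectionSupB8_flatCfg`** — `LandauCorrectionSupB8 hL j hWu hx hs hWx N hθ K₀ K₁` at `W = 1` for EVERY `N ≥ 1`, `L ≥ 2`, `j`, UNCONDITIONALLY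
  (`K₀ = 6d·liftC·16d³·c_R`, `K₁ = 6d·liftC·16d²·c_R`): gen 7's `landauCorrectionSupB8_flatCfg_of_supFacts` with BOTH displayed facts ((H0): R37; (HR): §3) proved.

CONTENT (0 sorry; no `def`; [folklore] lattice analysis).  HONEST FRAMING.  Statements at the TRIVIAL background `W = 1` only: they show that THE END's hypothesis
SHAPE `hK` is satisfied at the flat datum on every torus with `j`-independent constants (the non-vacuity check the census asked for, now for every `(L, N)`
including the headline `L = 2`), nothing about the curved backgrounds `W = cavg L U_B` of Bałaban's pairs; `hK`∕(P♮) at curved `W`, `PairLandauGaugeB8Avg`, the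
covariant root and **NE3 are NOT proved**; spine PROVED 0∕9; finite T⁴ rung (B)+1 — NOT infinite volume, NOT mass gap, NOT `BetaPertH`, NOT Clay.  PLACEMENT:
`Summits/QuantumFields/BalabanUV/T4Continuum/Spine/NE3/`; imports accepted modules only; moves nothing.  HONEST DEPENDENCY (cell page 1): continuum YM on T⁴ ⇐
BetaPertH ∧ nine spine estimates (0/9 proved); BetaPertH ⇐ (D1) ∧ (D4) ∧ CAP+tail; G-an2-4 gates asym, D1 and NE2/3/4.
-/

set_option autoImplicit false

open scoped BigOperators Matrix Matrix.Norms.L2Operator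
open NormedSpace Finset

namespace Summit.QuantumFields.BalabanUV.T4Continuum.NE3.LandauProjectionSupFlat


open Literature.MathematicalPhysics.QuantumFieldTheory.Balaban1983to89
open B7Prop1Explicit B7Prop2Explicit MatrixNorms
open T4AveragingDeficitWall (IsUnitaryCfg IsSkewDir SmallField)
open T4AveragingDeficitWallBoundary (IsPeriodicCfg periodBox mem_periodBox card_periodBox)
open AveragingDeficitPeriodicCounting (IsPeriodicDir)
open AveragingDeficitMultiLevelPrep (LevelSmall)
open AveragingDeficitTorusChart (periodic_smul_vec)
open BlockAveragePushDirGauge (gaugeDir isPeriodicDir_gaugeDir)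
open MinimalActionWitness (flatCfg isPeriodicCfg_flatCfg)
open SmoothRefineBlocks (blk blk_res_add_period)
open SkeletonLattice (cdiv cmod smul_cdiv_add_cmod cmod_nonneg cmod_lt)
open NE3QbarIterCovLiftPrep (cruxC liftC)
open NE3CovariantCalculus (hsR hsR_self hsR_comm hsR_sub_left hsR_sum_right nhsNormSq_sub nhsNormSq_neg)
open NE3CovariantWeitzenbock (covDiv)
open NE3CovariantBlockMean (bmeanIterW)
open NE3TangentNoGoWords (dPot)
open NE3LandauOrbit (sum_hsR_gaugeDir gaugeDir_skew eq_zero_of_nhsNormSq_eq_zero hsR_zero_right)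
open NE3CurvedCornerGaugeSpace (covDiv_mem_skewAdjoint)
open NE3FrameFreeSliceUnique (gaugeDir_flatCfg_eq_neg_dPot eq_zero_of_periodic_of_box)
open NE3FlatHessianCurl (isUnitaryCfg_flatCfg)
open NE3.PairLandauB8 (avgKernelGauges covLapSite)
open NE3.LandauProjectionB8 (covDiv_gaugeDir_eq_covLapSite covLapSite_add_period sum_nhsNormSq_gaugeDir_eq)
open NE3.LandauProjectionSupShape (LandauCorrectionSupB8)
open NE3.LandauCorrectionSupB8FlatH0 (norm_covLapSite_flatCfg landauCorrectionSupB8_flatCfg_of_projectionSup)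
open NE3DiscreteGradientEstimate (supRegularity_of_blockMeanZero)
open NE3.FlatBlockHarmonicInverse (covLapSite_eq_blockMean blockMean_add_period blockMean_energy_le)

noncomputable section

variable {d : ℕ} {n : Type*} [Fintype n] [DecidableEq n]

/-! ## §3 (HR) at the flat datum -/

/-- **(HR) AT THE FLAT DATUM — THE `ℓ^∞` BOUND OF B8's (1.38)-PROJECTION `R(1)` ONTO `Δ_1N(Q′(1))`, k-UNIFORM** (every `d`, `L ≥ 2`, `N ≥ 1`, `j`): for a skew
`(N·L^{j+1})`-periodic `F` with `‖F‖_∞ ≤ B` and `μ ∈ N(Q′(1)) = avgKernelGauges L N (j+1) 1` with `Σ hsR (F + Δ_1μ)(Δ_1ν) = 0` for all `ν ∈ N(Q′(1))`: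
`‖Δ_1μ(y)‖ ≤ (1 + card n + 64^{2d+1}·d⁴·(card n)²·N^{d+2})·B` — EXACTLY the binder `hR` of `landauCorrectionSupB8_flatCfg_of_supFacts` ([Balaban1985BackgroundPropagators]
(3.25)∕(3.49) for `P = I − R` at `U = 1`, here PROVED). [folklore] -/
theorem covLapSite_sup_le_flatCfg [Nonempty n] {L N : ℕ} (hL : 2 ≤ L) (hN : 1 ≤ N) (j : ℕ)
    (F : Site d → Matrix n n ℂ) (hFs : ∀ y : Site d, F y ∈ skewAdjoint (Matrix n n ℂ))
    (hFP : ∀ (y : Site d) (i : Fin d), F (y + ((N * L ^ (j + 1) : ℕ) : ℤ) • e i) = F y)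
    {mu : Site d → Matrix n n ℂ} (hmu : mu ∈ avgKernelGauges (d := d) (n := n) L N (j + 1) (flatCfg (d := d) (n := n)))
    (horth : ∀ nu ∈ avgKernelGauges (d := d) (n := n) L N (j + 1) (flatCfg (d := d) (n := n)),
      ∑ y ∈ periodBox (d := d) (N * L ^ (j + 1)),
        hsR (F y + covLapSite (flatCfg (d := d) (n := n)) mu y) (covLapSite (flatCfg (d := d) (n := n)) nu y) = 0)
    {B : ℝ} (hFB : ∀ y : Site d, ‖F y‖ ≤ B) (y : Site d) :
    ‖covLapSite (flatCfg (d := d) (n := n)) mu y‖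
      ≤ (1 + (Fintype.card n : ℝ) + (64 : ℝ) ^ (2 * d + 1) * (d : ℝ) ^ 4 * (Fintype.card n : ℝ) ^ 2 * (N : ℝ) ^ (d + 2)) * B := by
  have hL1 : 1 ≤ L := by omega
  set M : ℕ := L ^ (j + 1) with hM_def
  have hM2 : 2 ≤ M := le_trans hL (Nat.le_self_pow (by omega) L)
  have hM1 : 1 ≤ M := by omega
  have hM0 : (0 : ℝ) < M := by exact_mod_cast (by omega : 0 < M)
  set P : ℕ := N * M with hP_def
  have hP : 1 ≤ P := Nat.mul_pos (by omega) (by omega)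
  have hP0 : (0 : ℝ) < P := by exact_mod_cast hP
  have hN0 : (0 : ℝ) < N := by exact_mod_cast hN
  have hWu : IsUnitaryCfg (flatCfg (d := d) (n := n)) := isUnitaryCfg_flatCfg
  have hWP : IsPeriodicCfg (flatCfg (d := d) (n := n)) (P : ℤ) := isPeriodicCfg_flatCfg _
  set cn : ℝ := (Fintype.card n : ℝ) with hcn_def
  have hcn1 : (1 : ℝ) ≤ cn := by rw [hcn_def]; exact_mod_cast Fintype.card_pos
  have hB0 : 0 ≤ B := (norm_nonneg _).trans (hFB 0)
  have hmus := hmu.1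
  have hmuP := hmu.2.1
  -- `g := F + Δ_1μ`: skew, periodic
  set g : Site d → Matrix n n ℂ := fun x => F x + covLapSite (flatCfg (d := d) (n := n)) mu x with hg_def
  have hlaps : ∀ x : Site d, covLapSite (flatCfg (d := d) (n := n)) mu x ∈ skewAdjoint (Matrix n n ℂ) := fun x => by
    rw [← covDiv_gaugeDir_eq_covLapSite]; exact covDiv_mem_skewAdjoint hWu (gaugeDir_skew hWu hmus) x
  have hgs : ∀ x : Site d, g x ∈ skewAdjoint (Matrix n n ℂ) := fun x => (skewAdjoint _).add_mem (hFs x) (hlaps x)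
  have hgP : ∀ (x : Site d) (i : Fin d), g (x + (P : ℤ) • e i) = g x := fun x i => by
    simp only [hg_def, hFP x i, covLapSite_add_period hWP hmuP x i]
  have horth' : ∀ nu ∈ avgKernelGauges (d := d) (n := n) L N (j + 1) (flatCfg (d := d) (n := n)),
      ∑ x ∈ periodBox (d := d) P, hsR (g x) (covLapSite (flatCfg (d := d) (n := n)) nu x) = 0 := horth
  -- the case `d = 0`: the Laplacian is an empty sum
  rcases Nat.eq_zero_or_pos d with hd | hd
  · subst hd
    have h0 : covLapSite (flatCfg (d := 0) (n := n)) mu y = 0 := by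
      unfold covLapSite; simp
    rw [h0, norm_zero]; exact mul_nonneg (by positivity) hB0
  -- §1: the Laplacian of `g` is block-constant
  set a : Site d → Matrix n n ℂ := fun z => ((((M : ℕ) : ℝ) ^ d)⁻¹ : ℝ) •
    ∑ v ∈ periodBox (d := d) M, covLapSite (flatCfg (d := d) (n := n)) g (((M : ℕ) : ℤ) • z + v) with ha_def
  have ha : ∀ x : Site d, covLapSite (flatCfg (d := d) (n := n)) g x = a (blk M x) :=
    covLapSite_eq_blockMean hL hN j hgs hgP horth' a (fun z => rfl)
  have haP : ∀ (z : Site d) (i : Fin d), a (z + (N : ℤ) • e i) = a z := blockMean_add_period j hgP a (fun z => rfl)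
  -- §2: the inverse inequality
  set A : ℝ := ∑ z ∈ periodBox (d := d) N, nhsNormSq (a z) with hA_def
  set Gn : ℝ := ∑ x ∈ periodBox (d := d) P, nhsNormSq (g x) with hGn_def
  have hA0 : 0 ≤ A := Finset.sum_nonneg fun z _ => nhsNormSq_nonneg _
  have hinv : A * (M : ℝ) ^ (d + 4) ≤ 16 * (d : ℝ) ^ 2 * cn ^ 2 * (64 : ℝ) ^ (4 * d) * Gn := blockMean_energy_le hM2 hN hgP haP ha
  -- `Gn ≤ Σ nhsNormSq F ≤ P^d B²` (orthogonality against `ν := μ`)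
  have hGnF : Gn ≤ (P : ℝ) ^ d * B ^ 2 := by
    have h1 : ∀ x, nhsNormSq (F x) = nhsNormSq (g x) + nhsNormSq (covLapSite (flatCfg (d := d) (n := n)) mu x)
        - 2 * hsR (g x) (covLapSite (flatCfg (d := d) (n := n)) mu x) := fun x => by
      rw [← nhsNormSq_sub]; simp [hg_def]
    have h2 : ∑ x ∈ periodBox (d := d) P, nhsNormSq (F x)
        = Gn + ∑ x ∈ periodBox (d := d) P, nhsNormSq (covLapSite (flatCfg (d := d) (n := n)) mu x) := by
      simp only [h1, Finset.sum_sub_distrib, Finset.sum_add_distrib, ← Finset.mul_sum, horth' mu hmu]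
      ring
    have h3 : ∑ x ∈ periodBox (d := d) P, nhsNormSq (F x) ≤ (P : ℝ) ^ d * B ^ 2 := by
      calc ∑ x ∈ periodBox (d := d) P, nhsNormSq (F x) ≤ ∑ _x ∈ periodBox (d := d) P, B ^ 2 :=
            Finset.sum_le_sum fun x _ => (nhsNormSq_le_opNorm_sq _).trans (pow_le_pow_left₀ (norm_nonneg _) (hFB x) 2)
        _ = (P : ℝ) ^ d * B ^ 2 := by rw [Finset.sum_const, card_periodBox, nsmul_eq_mul]; push_cast; ring
    have h4 : 0 ≤ ∑ x ∈ periodBox (d := d) P, nhsNormSq (covLapSite (flatCfg (d := d) (n := n)) mu x) :=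
      Finset.sum_nonneg fun x _ => nhsNormSq_nonneg _
    linarith
  -- every block mean is controlled by `A` (periodicity of `a` on the coarse torus)
  have hcn0 : 0 ≤ cn := by linarith
  have haA : ∀ z : Site d, nhsNormSq (a z) ≤ A := by
    intro z
    have hmem : cmod N z ∈ periodBox (d := d) N := (mem_periodBox).2 fun κ => ⟨cmod_nonneg hN z κ, cmod_lt hN z κ⟩
    have hz : a z = a (cmod N z) := by
      have h := periodic_smul_vec haP (cmod N z) (cdiv N z)
      rw [add_comm, smul_cdiv_add_cmod] at h
      exact h
    have h2 : nhsNormSq (a (cmod N z)) ≤ A := by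
      rw [hA_def]
      exact Finset.single_le_sum (fun w _ => nhsNormSq_nonneg (a w)) hmem
    exact (congrArg nhsNormSq hz).trans_le h2
  have haBound : ∀ z : Site d, ‖a z‖ ≤ Real.sqrt (cn * A) := by
    intro z
    have h1 : ‖a z‖ ^ 2 ≤ cn * A := (opNorm_sq_le_card_mul_nhsNormSq (a z)).trans (mul_le_mul_of_nonneg_left (haA z) hcn0)
    calc ‖a z‖ = Real.sqrt (‖a z‖ ^ 2) := (Real.sqrt_sq (norm_nonneg _)).symm
      _ ≤ Real.sqrt (cn * A) := Real.sqrt_le_sqrt h1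
  -- `u := g − mean g`: the maximum principle of R37 with ONE block = the whole torus
  set gbar : Matrix n n ℂ := (((P : ℝ) ^ d)⁻¹ : ℝ) • ∑ x ∈ periodBox (d := d) P, g x with hgbar_def
  set u : Site d → Matrix n n ℂ := fun x => g x - gbar with hu_def
  have hgPu : ∀ (x : Site d) (τ : Fin d), u (x + (P : ℤ) • e τ) = u x := fun x τ => by simp only [hu_def, hgP x τ]
  have hperu : ∀ (x : Site d) (τ : Fin d), u (x + ((1 * P : ℕ) : ℤ) • e τ) = u x := fun x τ => by
    rw [Nat.one_mul]; exact hgPu x τ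
  have hPd : (0 : ℝ) < (P : ℝ) ^ d := by positivity
  have hmeanu : ∀ z : Site d, ∑ v ∈ periodBox (d := d) P, u ((P : ℤ) • z + v) = 0 := by
    intro z
    have h1 : ∀ v : Site d, u ((P : ℤ) • z + v) = u v := fun v => by rw [add_comm]; exact periodic_smul_vec hgPu v z
    rw [Finset.sum_congr rfl fun v _ => h1 v]
    simp only [hu_def, Finset.sum_sub_distrib, Finset.sum_const, card_periodBox, hgbar_def]
    rw [← Nat.cast_smul_eq_nsmul ℝ, smul_smul]
    push_cast
    rw [mul_inv_cancel₀ hPd.ne', one_smul, sub_self]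
  have hlapu : ∀ x : Site d, ‖∑ i : Fin d, ((u (x + e i) - u x) - (u x - u (x - e i)))‖ ≤ Real.sqrt (cn * A) := by
    intro x
    have h1 : ∑ i : Fin d, ((u (x + e i) - u x) - (u x - u (x - e i))) = ∑ i : Fin d, ((g (x + e i) - g x) - (g x - g (x - e i))) :=
      Finset.sum_congr rfl fun i _ => by simp only [hu_def]; abel
    rw [h1, ← norm_covLapSite_flatCfg, ha x]
    exact haBound _
  obtain ⟨-, hU⟩ := supRegularity_of_blockMeanZero (E := Matrix n n ℂ) hd hP (le_refl 1) u hperu hmeanu hlapu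
  -- `‖mean g‖ ≤ √(card n)·B`
  have hGsum : ∑ x ∈ periodBox (d := d) P, ‖g x‖ ≤ (P : ℝ) ^ d * (Real.sqrt cn * B) := by
    have h1 := sq_sum_le_card_mul_sum_sq (s := periodBox (d := d) P) (f := fun x => ‖g x‖)
    rw [card_periodBox] at h1
    push_cast at h1
    have h2 : ∑ x ∈ periodBox (d := d) P, ‖g x‖ ^ 2 ≤ cn * Gn := by
      rw [hGn_def, Finset.mul_sum]
      exact Finset.sum_le_sum fun x _ => opNorm_sq_le_card_mul_nhsNormSq (g x)
    have h3 : (∑ x ∈ periodBox (d := d) P, ‖g x‖) ^ 2 ≤ ((P : ℝ) ^ d * (Real.sqrt cn * B)) ^ 2 := by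
      calc (∑ x ∈ periodBox (d := d) P, ‖g x‖) ^ 2 ≤ (P : ℝ) ^ d * ∑ x ∈ periodBox (d := d) P, ‖g x‖ ^ 2 := h1
        _ ≤ (P : ℝ) ^ d * (cn * ((P : ℝ) ^ d * B ^ 2)) :=
            mul_le_mul_of_nonneg_left (h2.trans (mul_le_mul_of_nonneg_left hGnF hcn0)) hPd.le
        _ = ((P : ℝ) ^ d * (Real.sqrt cn * B)) ^ 2 := by rw [mul_pow, mul_pow, Real.sq_sqrt hcn0]; ring
    exact (pow_le_pow_iff_left₀ (Finset.sum_nonneg fun x _ => norm_nonneg _) (by positivity) two_ne_zero).mp h3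
  have hgbar : ‖gbar‖ ≤ Real.sqrt cn * B := by
    rw [hgbar_def, norm_smul, norm_inv, Real.norm_of_nonneg hPd.le]
    calc ((P : ℝ) ^ d)⁻¹ * ‖∑ x ∈ periodBox (d := d) P, g x‖ ≤ ((P : ℝ) ^ d)⁻¹ * ((P : ℝ) ^ d * (Real.sqrt cn * B)) :=
          mul_le_mul_of_nonneg_left ((norm_sum_le _ _).trans hGsum) (by positivity)
      _ = Real.sqrt cn * B := by field_simp
  -- all powers of `M` cancel: `M²·√(cn·A) ≤ 4d·cn²·64^{2d}·N^d·B`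
  have hPNM : (P : ℝ) = (N : ℝ) * M := by rw [hP_def]; push_cast; ring
  have hcancel : (M : ℝ) ^ 2 * Real.sqrt (cn * A) ≤ 4 * (d : ℝ) * cn ^ 2 * (64 : ℝ) ^ (2 * d) * (N : ℝ) ^ d * B := by
    have hQ0 : 0 ≤ 4 * (d : ℝ) * cn ^ 2 * (64 : ℝ) ^ (2 * d) * (N : ℝ) ^ d * B := by positivity
    refine (pow_le_pow_iff_left₀ (by positivity) hQ0 two_ne_zero).mp ?_
    rw [mul_pow, Real.sq_sqrt (mul_nonneg hcn0 hA0)]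
    -- `M⁴·cn·A ≤ cn·C·N^d·B²` from `hinv`, `hGnF` and `P^d = N^d M^d`
    have h1 : A * (M : ℝ) ^ (d + 4) ≤ 16 * (d : ℝ) ^ 2 * cn ^ 2 * (64 : ℝ) ^ (4 * d) * ((N : ℝ) ^ d * (M : ℝ) ^ d * B ^ 2) := by
      refine hinv.trans (mul_le_mul_of_nonneg_left ?_ (by positivity))
      calc Gn ≤ (P : ℝ) ^ d * B ^ 2 := hGnF
        _ = (N : ℝ) ^ d * (M : ℝ) ^ d * B ^ 2 := by rw [hPNM, mul_pow]
    have hMd0 : (0 : ℝ) < (M : ℝ) ^ d := by positivity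
    have h2 : A * (M : ℝ) ^ 4 ≤ 16 * (d : ℝ) ^ 2 * cn ^ 2 * (64 : ℝ) ^ (4 * d) * ((N : ℝ) ^ d * B ^ 2) := by
      have h3 : (A * (M : ℝ) ^ 4) * (M : ℝ) ^ d ≤ (16 * (d : ℝ) ^ 2 * cn ^ 2 * (64 : ℝ) ^ (4 * d) * ((N : ℝ) ^ d * B ^ 2)) * (M : ℝ) ^ d := by
        have e1 : (A * (M : ℝ) ^ 4) * (M : ℝ) ^ d = A * (M : ℝ) ^ (d + 4) := by ring
        have e2 : (16 * (d : ℝ) ^ 2 * cn ^ 2 * (64 : ℝ) ^ (4 * d) * ((N : ℝ) ^ d * B ^ 2)) * (M : ℝ) ^ d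
            = 16 * (d : ℝ) ^ 2 * cn ^ 2 * (64 : ℝ) ^ (4 * d) * ((N : ℝ) ^ d * (M : ℝ) ^ d * B ^ 2) := by ring
        rw [e1, e2]; exact h1
      exact le_of_mul_le_mul_right h3 hMd0
    have hcnN : 1 ≤ cn * (N : ℝ) ^ d := one_le_mul_of_one_le_of_one_le hcn1 (one_le_pow₀ (by exact_mod_cast hN))
    have h64 : (64 : ℝ) ^ (4 * d) = ((64 : ℝ) ^ (2 * d)) ^ 2 := by rw [← pow_mul]; ring_nf
    have h4 : ((M : ℝ) ^ 2) ^ 2 * (cn * A) = cn * (A * (M : ℝ) ^ 4) := by ring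
    rw [h4]
    have h5 : cn * (A * (M : ℝ) ^ 4) ≤ cn * (16 * (d : ℝ) ^ 2 * cn ^ 2 * (64 : ℝ) ^ (4 * d) * ((N : ℝ) ^ d * B ^ 2)) :=
      mul_le_mul_of_nonneg_left h2 hcn0
    have h6 : cn * (16 * (d : ℝ) ^ 2 * cn ^ 2 * (64 : ℝ) ^ (4 * d) * ((N : ℝ) ^ d * B ^ 2))
        ≤ (4 * (d : ℝ) * cn ^ 2 * (64 : ℝ) ^ (2 * d) * (N : ℝ) ^ d * B) ^ 2 := by
      rw [h64]
      have h7 : (4 * (d : ℝ) * cn ^ 2 * ((64 : ℝ) ^ (2 * d)) * (N : ℝ) ^ d * B) ^ 2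
          = cn * (16 * (d : ℝ) ^ 2 * cn ^ 2 * ((64 : ℝ) ^ (2 * d)) ^ 2 * ((N : ℝ) ^ d * B ^ 2)) * (cn * (N : ℝ) ^ d) := by ring
      rw [h7]
      exact le_mul_of_one_le_right (by positivity) hcnN
    exact h5.trans h6
  -- assemble
  have hsqcn : Real.sqrt cn ≤ cn := by
    calc Real.sqrt cn ≤ Real.sqrt (cn ^ 2) := Real.sqrt_le_sqrt (by nlinarith)
      _ = cn := Real.sqrt_sq hcn0
  have huy : ‖u y‖ ≤ 64 * (d : ℝ) ^ 4 * cn ^ 2 * (64 : ℝ) ^ (2 * d) * (N : ℝ) ^ (d + 2) * B := by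
    have h1 := hU y
    have h2 : (16 : ℝ) * (d : ℝ) ^ 3 * (P : ℝ) ^ 2 * Real.sqrt (cn * A)
        = 16 * (d : ℝ) ^ 3 * (N : ℝ) ^ 2 * ((M : ℝ) ^ 2 * Real.sqrt (cn * A)) := by
      rw [hPNM]; ring
    rw [h2] at h1
    have h3 : 16 * (d : ℝ) ^ 3 * (N : ℝ) ^ 2 * ((M : ℝ) ^ 2 * Real.sqrt (cn * A))
        ≤ 16 * (d : ℝ) ^ 3 * (N : ℝ) ^ 2 * (4 * (d : ℝ) * cn ^ 2 * (64 : ℝ) ^ (2 * d) * (N : ℝ) ^ d * B) :=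
      mul_le_mul_of_nonneg_left hcancel (by positivity)
    have h4 : 16 * (d : ℝ) ^ 3 * (N : ℝ) ^ 2 * (4 * (d : ℝ) * cn ^ 2 * (64 : ℝ) ^ (2 * d) * (N : ℝ) ^ d * B)
        = 64 * (d : ℝ) ^ 4 * cn ^ 2 * (64 : ℝ) ^ (2 * d) * (N : ℝ) ^ (d + 2) * B := by ring
    linarith
  have hgy : ‖g y‖ ≤ Real.sqrt cn * B + 64 * (d : ℝ) ^ 4 * cn ^ 2 * (64 : ℝ) ^ (2 * d) * (N : ℝ) ^ (d + 2) * B := by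
    have h1 : g y = gbar + u y := by simp only [hu_def]; abel
    rw [h1]
    exact (norm_add_le _ _).trans (add_le_add hgbar huy)
  have hfin : covLapSite (flatCfg (d := d) (n := n)) mu y = g y - F y := by simp only [hg_def]; abel
  rw [hfin]
  have h64' : (64 : ℝ) ^ (2 * d + 1) = 64 * (64 : ℝ) ^ (2 * d) := by rw [pow_succ]; ring
  calc ‖g y - F y‖ ≤ ‖g y‖ + ‖F y‖ := norm_sub_le _ _
    _ ≤ (Real.sqrt cn * B + 64 * (d : ℝ) ^ 4 * cn ^ 2 * (64 : ℝ) ^ (2 * d) * (N : ℝ) ^ (d + 2) * B) + B := add_le_add hgy (hFB y)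
    _ ≤ (1 + cn + (64 : ℝ) ^ (2 * d + 1) * (d : ℝ) ^ 4 * cn ^ 2 * (N : ℝ) ^ (d + 2)) * B := by
        rw [h64']
        have : Real.sqrt cn * B ≤ cn * B := mul_le_mul_of_nonneg_right hsqcn hB0
        nlinarith [this]

/-! ## §4 The END's sup letter `hK` at the flat datum, unconditionally, on every torus -/

/-- **`hK` AT `W = 1` ON EVERY TORUS — UNCONDITIONAL** (every `d`, `L ≥ 2`, `N ≥ 1`, `j`; `M = L^{j+1}`): `LandauCorrectionSupB8 hL j hWu hx hs hWx N hθ K₀ K₁` with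
`K₀ = 6d·liftC·16d³·c_R`, `K₁ = 6d·liftC·16d²·c_R`, `c_R = 1 + card n + 64^{2d+1}d⁴(card n)²N^{d+2}` — INDEPENDENT of `j`: gen 7's reduction
`landauCorrectionSupB8_flatCfg_of_supFacts` with (H0) (R37, `LandauCorrectionSupB8FlatH0.supRegularity_flatCfg`) and (HR) (§3) both PROVED.  The END's
hypothesis shape `hK` is thus satisfied at the trivial datum on every torus, k-uniformly; nothing about curved backgrounds. [folklore] -/
theorem landauCorrectionSupB8_flatCfg [Nonempty n] {L : ℕ} (hL : 2 ≤ L) (j : ℕ) {x : ℝ}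
    (hWu : IsUnitaryCfg (flatCfg (d := d) (n := n))) (hx : 0 ≤ x) (hs : LevelSmall d L j x) (hWx : SmallField (flatCfg (d := d) (n := n)) x)
    (N : ℕ) [NeZero N] (hθ : cruxC d L * (((L : ℝ) ^ (j + 1)) ^ 2 * x) < 1) :
    LandauCorrectionSupB8 hL j hWu hx hs hWx N hθ
      (6 * (d : ℝ) * liftC d * (16 * (d : ℝ) ^ 3)
        * (1 + (Fintype.card n : ℝ) + (64 : ℝ) ^ (2 * d + 1) * (d : ℝ) ^ 4 * (Fintype.card n : ℝ) ^ 2 * (N : ℝ) ^ (d + 2)))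
      (6 * (d : ℝ) * liftC d * (16 * (d : ℝ) ^ 2)
        * (1 + (Fintype.card n : ℝ) + (64 : ℝ) ^ (2 * d + 1) * (d : ℝ) ^ 4 * (Fintype.card n : ℝ) ^ 2 * (N : ℝ) ^ (d + 2))) :=
  landauCorrectionSupB8_flatCfg_of_projectionSup hL j hWu hx hs hWx N hθ
    (fun F hFs hFP _ hmu horth _ hFB y =>
      covLapSite_sup_le_flatCfg hL (Nat.one_le_iff_ne_zero.mpr (NeZero.ne N)) j F hFs hFP hmu horth hFB y)

end

end Summit.QuantumFields.BalabanUV.T4Continuum.NE3.LandauProjectionSupFlat
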